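import Summits.NavierStokesRegularity.FluidComputer.PalasekTowerSuperposedRunNear

/-!
# THE SUPERPOSED RUN, II: the FREE Navier–Stokes run from the superposed datum `v₁(0) + v₂(0, · − c)`
# exists classically on the whole slab and shadows the superposition `v₁ + v₂(· − c)`

Cell `ns-blowup`, seat `ns-blowup-ecbridge-3` (g7; D-0074 GROUP C «BRIDGE SUPPORT», lineage
`host_preparation`; bears_on LADDER-NS N1, route `PalasekTowerBreakdown`, crux `EpisodeBase` = item
stmt-NavierStokesRegularity-19179, line `slot` v5). LABEL: E–C typing + kernel analysis (theorems only;
no definition, no named fact, no `sorry`). WHAT THIS IS NOT: not Navier–Stokes evidence — an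
EXISTENCE-AND-CLOSENESS theorem for the free system next to a GIVEN pair of free classical runs on a FIXED
slab; no stage, host, episode or blow-up is constructed or asserted.

## The theorem (`SuperposedRun.exists_free_run_near_superposed`)

Let `v₁`, `v₂` be classical solutions of the UNFORCED Navier–Stokes system (`ν = 1`) on `[0, T] × ℝ³` with
finite energy and `‖v₁‖ ≤ M₁`, `‖v₂‖ ≤ M₂`, let `c ∈ ℝ³`, and suppose the superposition
`ṽ(t, x) = v₁(t, x) + v₂(t, x − c)` is bounded by `M` and its cross Duhamel term
`Φ_c = B(ṽ, ṽ) − B(v₁, v₁) − B(v₂c, v₂c)` by `F`, with `2F · exp (36 C₀² (2M+1)² T) ≤ 1/2` (part I: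
`F = 2 C₀ (η₁ M₂ + M₁ η₂) 2√T` when the runs are `η`-small off `B(0, ρ)` and `‖c‖ ≥ 2ρ`). If the superposed
datum `ṽ(0)` is divergence free and Schwartz, the UNFORCED system has a classical finite-energy solution
`(u, p)` on the whole slab `[0, T] × ℝ³` with `u(0) = ṽ(0)` and
`‖u(t, x) − ṽ(t, x)‖ ≤ 2F exp (36 C₀² (2M+1)² t) (≤ 1/2)` everywhere.

## The argument (maximal classical solution; verbatim the tree's `PerturbedRun.exists_forced_run_near_free_run`
## with the free reference run replaced by the superposition)

Let `s⋆` be the supremum of the times `s ∈ (0, T]` for which a classical finite-energy free run from `ṽ(0)`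
exists on `[0, s]` (nonempty by `PerturbedRun.exists_local_forcedRun` with the zero force). Runs on
different slabs agree (`freeRun_unique_superposed`), so the runs below `s⋆` glue to a classical solution on
`[0, s⋆)` whose velocity is bounded by `M + 1/2` (`freeRun_near_superposed`) and whose energy is bounded by
Tao's energy inequality; it therefore extends classically PAST `s⋆`
(`ForcedContinuation.exists_extension_of_bounded_Ico`). Hence `s⋆ = T` is attained.

References: T. Tao, Anal. PDE 6 (2013), Thm. 5.4, Lemma 8.1 [cite: Tao2011, Thm. 5.4 (ii)+(iv)];
J. Leray, Acta Math. 63 (1934) §19 [cite: Leray1934, §19 (3.4)–(3.8)]; J. C. Robinson, J. L. Rodrigo,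
W. Sadowski (2016), Thm. 8.17 (restart–identify–glue) [cite: RobinsonRodrigoSadowski2016, Thm. 8.17];
S. Palasek, arXiv:2605.13827 §4 [cite: Palasek2026ElementaryModel, §4].
-/

noncomputable section

namespace Summit.NavierStokesRegularity.FluidComputer.PalasekTowerClayBridge.SuperposedRun

open Set MeasureTheory Filter Topology Function Real
open scoped ENNReal NNReal ContDiff
open Literature.Analysis Literature.Analysis.FluidPDE

section Main

variable {T M₁ M₂ : ℝ} {v₁ v₂ : ℝ → EuclideanSpace ℝ (Fin 3) → EuclideanSpace ℝ (Fin 3)}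
  {q₁ q₂ : ℝ → EuclideanSpace ℝ (Fin 3) → ℝ}

/-- **THE SUPERPOSED RUN.** Under the hypotheses of `freeRun_near_superposed` (free classical bounded
finite-energy runs `v₁, v₂` on `[0, T] × ℝ³`, `‖v₁ + v₂(· − c)‖ ≤ M`, cross Duhamel term `≤ F`,
`2F exp (36 C₀² (2M+1)² T) ≤ 1/2`, Schwartz superposed datum), if moreover the superposed datum is
divergence free, then the UNFORCED Navier–Stokes system (`ν = 1`) has a classical finite-energy solution
`(u, p)` on `[0, T] × ℝ³` with `u 0 = v₁(0) + v₂(0, · − c)` and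
`‖u(t,x) − (v₁(t,x) + v₂(t,x−c))‖ ≤ 2F exp (36 C₀² (2M+1)² t)` for all `t ∈ [0, T]`, `x`.
[cite: Tao2011, Thm. 5.4 (ii)+(iv)] [cite: Leray1934, §19 (3.4)–(3.8)] -/
theorem exists_free_run_near_superposed (hT : 0 < T)
    (h₁ : IsClassicalNSSolutionOn (Icc 0 T) 1 0 v₁ q₁)
    (hE₁ : ∃ C : ℝ≥0∞, C < ⊤ ∧ ∀ t ∈ Icc 0 T, ∫⁻ x, ‖v₁ t x‖ₑ ^ 2 ≤ C)
    (hM₁ : 0 < M₁) (hbd₁ : ∀ t ∈ Icc 0 T, ∀ y, ‖v₁ t y‖ ≤ M₁)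
    (h₂ : IsClassicalNSSolutionOn (Icc 0 T) 1 0 v₂ q₂)
    (hE₂ : ∃ C : ℝ≥0∞, C < ⊤ ∧ ∀ t ∈ Icc 0 T, ∫⁻ x, ‖v₂ t x‖ₑ ^ 2 ≤ C)
    (hM₂ : 0 < M₂) (hbd₂ : ∀ t ∈ Icc 0 T, ∀ y, ‖v₂ t y‖ ≤ M₂)
    (c : EuclideanSpace ℝ (Fin 3)) {M F : ℝ} (hM : 0 < M)
    (hbd : ∀ t ∈ Icc 0 T, ∀ x, ‖v₁ t x + v₂ t (x - c)‖ ≤ M) (hF0 : 0 ≤ F)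
    (hF : ∀ t ∈ Ioc 0 T, ∀ x,
      ‖oseenDuhamel 1 0 (fun t x => v₁ t x + v₂ t (x - c)) (fun t x => v₁ t x + v₂ t (x - c)) t x -
        oseenDuhamel 1 0 v₁ v₁ t x -
        oseenDuhamel 1 0 (fun t x => v₂ t (x - c)) (fun t x => v₂ t (x - c)) t x‖ ≤ F)
    (hsmall : 2 * F *
      Real.exp (36 * oseenSliceConst (EuclideanSpace ℝ (Fin 3)) ^ 2 * (M + (M + 1)) ^ 2 / 1 * T) ≤ 1 / 2)
    (h0 : HasRapidSpatialDecay (fun x => v₁ 0 x + v₂ 0 (x - c)))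
    (hdiv0 : VectorCalculus.IsDivFree (fun x => v₁ 0 x + v₂ 0 (x - c))) :
    ∃ (u : ℝ → EuclideanSpace ℝ (Fin 3) → EuclideanSpace ℝ (Fin 3))
      (p : ℝ → EuclideanSpace ℝ (Fin 3) → ℝ),
      IsClassicalNSSolutionOn (Icc 0 T) 1 0 u p ∧ (u 0 = fun x => v₁ 0 x + v₂ 0 (x - c)) ∧
      (∃ C : ℝ≥0∞, C < ⊤ ∧ ∀ t ∈ Icc 0 T, ∫⁻ x, ‖u t x‖ₑ ^ 2 ≤ C) ∧
      ∀ t ∈ Icc 0 T, ∀ x, ‖u t x - (v₁ t x + v₂ t (x - c))‖ ≤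
        2 * F * Real.exp (36 * oseenSliceConst (EuclideanSpace ℝ (Fin 3)) ^ 2 * (M + (M + 1)) ^ 2 / 1 * t) := by
  classical
  have hν : (0 : ℝ) < 1 := one_pos
  have hs := (Literature.Claims.NS.ClayVariants.isSmoothOnHalfSpace_zero
    (E := EuclideanSpace ℝ (Fin 3)) (F := EuclideanSpace ℝ (Fin 3)))
  have hd := (Literature.Claims.NS.ClayVariants.hasRapidSpaceTimeDecay_zero
    (E := EuclideanSpace ℝ (Fin 3)) (F := EuclideanSpace ℝ (Fin 3)))
  set a : EuclideanSpace ℝ (Fin 3) → EuclideanSpace ℝ (Fin 3) := fun x => v₁ 0 x + v₂ 0 (x - c) with ha_def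
  have h0T : (0 : ℝ) ∈ Icc 0 T := ⟨le_rfl, hT.le⟩
  have h₂c := translate h₂ c
  have ha_smooth : ContDiff ℝ ∞ a :=
    (h₁.contDiff_velocity h0T).add (h₂c.contDiff_velocity h0T)
  -- the two tools of part I-b, specialised to the present data
  have bound := fun {s : ℝ} (hs0 : 0 < s) (hsT : s ≤ T)
      {u' : ℝ → EuclideanSpace ℝ (Fin 3) → EuclideanSpace ℝ (Fin 3)}
      {p' : ℝ → EuclideanSpace ℝ (Fin 3) → ℝ}
      (hcl' : IsClassicalNSSolutionOn (Icc 0 s) 1 0 u' p') (hu'0 : u' 0 = a)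
      (hE' : ∃ C : ℝ≥0∞, C < ⊤ ∧ ∀ t ∈ Icc 0 s, ∫⁻ x, ‖u' t x‖ₑ ^ 2 ≤ C) =>
    freeRun_near_superposed hT h₁ hE₁ hM₁ hbd₁ h₂ hE₂ hM₂ hbd₂ c hM hbd hF0 hF hsmall h0 hs0 hsT hcl'
      hu'0 hE'
  have uniq := fun {s s' : ℝ} (hs0 : 0 < s) (hss' : s ≤ s') (hs'T : s' ≤ T)
      {u₁ u₂ : ℝ → EuclideanSpace ℝ (Fin 3) → EuclideanSpace ℝ (Fin 3)}
      {p₁ p₂ : ℝ → EuclideanSpace ℝ (Fin 3) → ℝ}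
      (hu₁ : IsClassicalNSSolutionOn (Icc 0 s) 1 0 u₁ p₁) (hu₁0 : u₁ 0 = a)
      (hEu₁ : ∃ C : ℝ≥0∞, C < ⊤ ∧ ∀ t ∈ Icc 0 s, ∫⁻ x, ‖u₁ t x‖ₑ ^ 2 ≤ C)
      (hu₂ : IsClassicalNSSolutionOn (Icc 0 s') 1 0 u₂ p₂) (hu₂0 : u₂ 0 = a)
      (hEu₂ : ∃ C : ℝ≥0∞, C < ⊤ ∧ ∀ t ∈ Icc 0 s', ∫⁻ x, ‖u₂ t x‖ₑ ^ 2 ≤ C) =>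
    freeRun_unique_superposed hT h₁ hE₁ hM₁ hbd₁ h₂ hE₂ hM₂ hbd₂ c hM hbd hF0 hF hsmall h0 hs0 hss' hs'T
      hu₁ hu₁0 hEu₁ hu₂ hu₂0 hEu₂
  -- ### force bookkeeping for the zero force
  obtain ⟨Cf₀, Cf₁, Bf, -, hCf₀, -, -⟩ := ForcedContinuation.exists_force_slice_bounds hs hd
  have hfE : ∀ s : ℝ, s ≤ T →
      ∫⁻ t in Icc 0 s, (∫⁻ x, ‖(0 : ℝ → EuclideanSpace ℝ (Fin 3) → EuclideanSpace ℝ (Fin 3)) t x‖ₑ ^ 2) ^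
          (1 / 2 : ℝ) ≤
        ∫⁻ t in Icc 0 T, (∫⁻ x, ‖(0 : ℝ → EuclideanSpace ℝ (Fin 3) → EuclideanSpace ℝ (Fin 3)) t x‖ₑ ^ 2) ^
          (1 / 2 : ℝ) :=
    fun s hsT => lintegral_mono_set (Icc_subset_Icc le_rfl hsT)
  have hfET : ∫⁻ t in Icc 0 T,
      (∫⁻ x, ‖(0 : ℝ → EuclideanSpace ℝ (Fin 3) → EuclideanSpace ℝ (Fin 3)) t x‖ₑ ^ 2) ^ (1 / 2 : ℝ) < ⊤ := by
    calc ∫⁻ t in Icc 0 T,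
          (∫⁻ x, ‖(0 : ℝ → EuclideanSpace ℝ (Fin 3) → EuclideanSpace ℝ (Fin 3)) t x‖ₑ ^ 2) ^ (1 / 2 : ℝ)
        ≤ ∫⁻ _t in Icc 0 T, (Cf₀ : ℝ≥0∞) ^ (1 / 2 : ℝ) :=
          setLIntegral_mono' measurableSet_Icc fun t ht =>
            ENNReal.rpow_le_rpow (hCf₀ t ht.1) (by norm_num)
      _ = (Cf₀ : ℝ≥0∞) ^ (1 / 2 : ℝ) * volume (Icc (0 : ℝ) T) := setLIntegral_const _ _
      _ < ⊤ := by
          rw [Real.volume_Icc]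
          exact ENNReal.mul_lt_top (ENNReal.rpow_lt_top_of_nonneg (by norm_num) ENNReal.coe_ne_top)
            ENNReal.ofReal_lt_top
  have ha_L2 : ∫⁻ x, ‖a x‖ₑ ^ 2 < ⊤ := by
    have h : ∫⁻ x, ‖iteratedFDeriv ℝ 0 a x‖ₑ ^ 2 < ⊤ := h0.lintegral_enorm_iteratedFDeriv_sq_lt_top 0
    have heq : ∫⁻ x, ‖a x‖ₑ ^ 2 = ∫⁻ x, ‖iteratedFDeriv ℝ 0 a x‖ₑ ^ 2 :=
      lintegral_congr fun x => by rw [← ofReal_norm, ← ofReal_norm, norm_iteratedFDeriv_zero]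
    rw [heq]; exact h
  -- ### the set of existence times and its supremum
  set 𝒮 : Set ℝ := {s | 0 < s ∧ s ≤ T ∧
      ∃ (u' : ℝ → EuclideanSpace ℝ (Fin 3) → EuclideanSpace ℝ (Fin 3))
        (p' : ℝ → EuclideanSpace ℝ (Fin 3) → ℝ),
        IsClassicalNSSolutionOn (Icc 0 s) 1 0 u' p' ∧ u' 0 = a ∧
        (∃ C : ℝ≥0∞, C < ⊤ ∧ ∀ t ∈ Icc 0 s, ∫⁻ x, ‖u' t x‖ₑ ^ 2 ≤ C)} with h𝒮
  obtain ⟨s₁, hs₁pos, hs₁T, u₁, p₁, hu₁, hu₁0, hE₁'⟩ :=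
    PerturbedRun.exists_local_forcedRun
      (f := (0 : ℝ → EuclideanSpace ℝ (Fin 3) → EuclideanSpace ℝ (Fin 3))) hν hT hs hd ha_smooth hdiv0 h0
  have hs₁mem : s₁ ∈ 𝒮 := ⟨hs₁pos, hs₁T, u₁, p₁, hu₁, hu₁0, hE₁'⟩
  have h𝒮ne : 𝒮.Nonempty := ⟨s₁, hs₁mem⟩
  have h𝒮bdd : BddAbove 𝒮 := ⟨T, fun s hs => hs.2.1⟩
  set sStar : ℝ := sSup 𝒮 with hsStar
  have hs₁le : s₁ ≤ sStar := le_csSup h𝒮bdd hs₁mem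
  have hsStarpos : 0 < sStar := lt_of_lt_of_le hs₁pos hs₁le
  have hsStarT : sStar ≤ T := csSup_le h𝒮ne fun s hs => hs.2.1
  -- every `s < s⋆` is an existence time (restriction of a later run)
  have hrun : ∀ s ∈ Ioo 0 sStar,
      ∃ (u' : ℝ → EuclideanSpace ℝ (Fin 3) → EuclideanSpace ℝ (Fin 3))
        (p' : ℝ → EuclideanSpace ℝ (Fin 3) → ℝ),
        IsClassicalNSSolutionOn (Icc 0 s) 1 0 u' p' ∧ u' 0 = a ∧
        (∃ C : ℝ≥0∞, C < ⊤ ∧ ∀ t ∈ Icc 0 s, ∫⁻ x, ‖u' t x‖ₑ ^ 2 ≤ C) := by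
    intro s hs
    obtain ⟨s', hs'mem, hss'⟩ := exists_lt_of_lt_csSup h𝒮ne hs.2
    obtain ⟨-, -, u', p', hu', hu'0, hE'⟩ := hs'mem
    have hsub : Icc 0 s ⊆ Icc 0 s' := Icc_subset_Icc le_rfl hss'.le
    refine ⟨u', p', hu'.mono hsub (uniqueDiffOn_Icc hs.1), hu'0, ?_⟩
    obtain ⟨C, hC, hb⟩ := hE'
    exact ⟨C, hC, fun t ht => hb t (hsub ht)⟩
  -- ### the coherent union on `[0, s⋆)`
  have hσ : ∀ t ∈ Ico 0 sStar, (t + sStar) / 2 ∈ Ioo 0 sStar ∧ t < (t + sStar) / 2 := fun t ht =>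
    ⟨⟨by linarith [ht.1], by linarith [ht.2]⟩, by linarith [ht.2]⟩
  have hchoice : ∀ t : ℝ, ∃ (u' : ℝ → EuclideanSpace ℝ (Fin 3) → EuclideanSpace ℝ (Fin 3))
      (p' : ℝ → EuclideanSpace ℝ (Fin 3) → ℝ), t ∈ Ico 0 sStar →
        IsClassicalNSSolutionOn (Icc 0 ((t + sStar) / 2)) 1 0 u' p' ∧ u' 0 = a ∧
        (∃ C : ℝ≥0∞, C < ⊤ ∧ ∀ τ ∈ Icc 0 ((t + sStar) / 2), ∫⁻ x, ‖u' τ x‖ₑ ^ 2 ≤ C) := by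
    intro t
    by_cases ht : t ∈ Ico 0 sStar
    · obtain ⟨u', p', h⟩ := hrun _ (hσ t ht).1
      exact ⟨u', p', fun _ => h⟩
    · exact ⟨fun _ _ => 0, fun _ _ => 0, fun h => absurd h ht⟩
  choose Uf Pf hUP using hchoice
  -- the union: velocity and normalised pressure
  set Us : ℝ → EuclideanSpace ℝ (Fin 3) → EuclideanSpace ℝ (Fin 3) := fun t => Uf t t with hUs
  set Ps : ℝ → EuclideanSpace ℝ (Fin 3) → ℝ := fun t x => Pf t t x - Pf t t 0 with hPs
  -- agreement with the run chosen at `t₀`, below `σ t₀`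
  have hagree : ∀ t₀ ∈ Ico 0 sStar, ∀ t ∈ Ico 0 ((t₀ + sStar) / 2),
      Us t = Uf t₀ t ∧ ∀ x, Ps t x = Pf t₀ t x - Pf t₀ t 0 := by
    intro t₀ ht₀ t ht
    obtain ⟨hσ₀, -⟩ := hσ t₀ ht₀
    have htS : t ∈ Ico 0 sStar := ⟨ht.1, ht.2.trans hσ₀.2⟩
    obtain ⟨hσt, htσt⟩ := hσ t htS
    obtain ⟨hcl₀, h0₀, hE₀⟩ := hUP t₀ ht₀
    obtain ⟨hclt, h0t, hEt⟩ := hUP t htS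
    -- the common slab `[0, m]`, `m = min (σ t) (σ t₀) > t`
    set m : ℝ := min ((t + sStar) / 2) ((t₀ + sStar) / 2) with hm
    have htm : t < m := lt_min htσt ht.2
    have hm₁ : m ≤ (t + sStar) / 2 := min_le_left _ _
    have hm₂ : m ≤ (t₀ + sStar) / 2 := min_le_right _ _
    have heq : ∀ τ ∈ Icc 0 m, Uf t τ = Uf t₀ τ := by
      rcases le_total ((t + sStar) / 2) ((t₀ + sStar) / 2) with hle | hle
      · have hmeq : m = (t + sStar) / 2 := min_eq_left hle
        intro τ hτ
        rw [hmeq] at hτ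
        exact (uniq hσt.1 hle (hσ₀.2.le.trans hsStarT) hclt h0t hEt hcl₀ h0₀ hE₀ τ hτ).symm
      · have hmeq : m = (t₀ + sStar) / 2 := min_eq_right hle
        intro τ hτ
        rw [hmeq] at hτ
        exact uniq hσ₀.1 hle (hσt.2.le.trans hsStarT) hcl₀ h0₀ hE₀ hclt h0t hEt τ hτ
    refine ⟨heq t ⟨ht.1, htm.le⟩, fun x => ?_⟩
    exact PerturbedRun.pressure_sub_apply_zero_eq_of_eqOn_Icc hclt hcl₀ hm₁ hm₂ heq ⟨ht.1, htm⟩ x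
  -- the union is classical on every closed sub-slab `[0, τ₁]`, `τ₁ < s⋆`
  have hIcc : ∀ τ₁ ∈ Ioo 0 sStar, IsClassicalNSSolutionOn (Icc 0 τ₁) 1 0 Us Ps := by
    intro τ₁ hτ₁
    have hτ₁' : τ₁ ∈ Ico 0 sStar := ⟨hτ₁.1.le, hτ₁.2⟩
    obtain ⟨-, hτσ₁⟩ := hσ τ₁ hτ₁'
    obtain ⟨hcl₁, -, -⟩ := hUP τ₁ hτ₁'
    have hsub : Icc 0 τ₁ ⊆ Icc 0 ((τ₁ + sStar) / 2) := Icc_subset_Icc le_rfl hτσ₁.le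
    have h1 : IsClassicalNSSolutionOn (Icc 0 τ₁) 1 0 (Uf τ₁) (fun t x => Pf τ₁ t x - Pf τ₁ t 0) :=
      (PerturbedRun.normalise_pressure hcl₁).mono hsub (uniqueDiffOn_Icc hτ₁.1)
    have hmemσ : ∀ t ∈ Icc 0 τ₁, t ∈ Ico 0 ((τ₁ + sStar) / 2) := fun t ht =>
      ⟨ht.1, lt_of_le_of_lt ht.2 hτσ₁⟩
    exact PerturbedRun.congr_pressure' (h1.congr_velocity fun t ht => (hagree τ₁ hτ₁' t (hmemσ t ht)).1)
      fun t ht => funext fun x => ((hagree τ₁ hτ₁' t (hmemσ t ht)).2 x)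
  have hIco : IsClassicalNSSolutionOn (Ico 0 sStar) 1 0 Us Ps :=
    PerturbedRun.isClassicalNSSolutionOn_Ico_of_forall_Icc hsStarpos hIcc
  -- datum, velocity bound and energy bound on `[0, s⋆)`
  have hUs0 : Us 0 = a := by
    obtain ⟨-, h00, -⟩ := hUP 0 ⟨le_rfl, hsStarpos⟩
    exact h00
  have hUsM : ∀ t ∈ Ico 0 sStar, ∀ x, ‖Us t x‖ ≤ M + 1 / 2 := by
    intro t ht x
    obtain ⟨hσt, htσt⟩ := hσ t ht
    obtain ⟨hclt, h0t, hEt⟩ := hUP t ht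
    exact (bound hσt.1 (hσt.2.le.trans hsStarT) hclt h0t hEt t ⟨ht.1, htσt.le⟩ x).2.2
  obtain ⟨CE, hCEtop, hEn⟩ := tao2011_forced_finiteEnergy_energyBound_holds
  set Ebd : ℝ≥0∞ := CE * ((∫⁻ x, ‖a x‖ₑ ^ 2) ^ (1 / 2 : ℝ) +
    ∫⁻ t in Icc 0 T,
      (∫⁻ x, ‖(0 : ℝ → EuclideanSpace ℝ (Fin 3) → EuclideanSpace ℝ (Fin 3)) t x‖ₑ ^ 2) ^ (1 / 2 : ℝ)) ^ 2
    with hEbd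
  have hEbdtop : Ebd < ⊤ := by
    refine ENNReal.mul_lt_top hCEtop (ENNReal.pow_lt_top (ENNReal.add_lt_top.2 ⟨?_, hfET⟩))
    exact ENNReal.rpow_lt_top_of_nonneg (by norm_num) ha_L2.ne
  have hUsE : ∃ C : ℝ≥0∞, C < ⊤ ∧ ∀ t ∈ Ico 0 sStar, ∫⁻ x, ‖Us t x‖ₑ ^ 2 ≤ C := by
    refine ⟨Ebd, hEbdtop, fun t ht => ?_⟩
    obtain ⟨hσt, htσt⟩ := hσ t ht
    obtain ⟨hclt, h0t, hEt⟩ := hUP t ht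
    have hEA : ∃ A : ℝ≥0, ∀ τ ∈ Icc 0 ((t + sStar) / 2), ∫⁻ x, ‖Uf t τ x‖ₑ ^ 2 ≤ A := by
      obtain ⟨C, hC, hb⟩ := hEt
      exact ⟨C.toNNReal, fun τ hτ => (hb τ hτ).trans (ENNReal.coe_toNNReal hC.ne).ge⟩
    have hfEσ : ∫⁻ τ in Icc 0 ((t + sStar) / 2),
        (∫⁻ x, ‖(0 : ℝ → EuclideanSpace ℝ (Fin 3) → EuclideanSpace ℝ (Fin 3)) τ x‖ₑ ^ 2) ^ (1 / 2 : ℝ) <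
          ⊤ :=
      lt_of_le_of_lt (hfE _ (hσt.2.le.trans hsStarT)) hfET
    have h1 := (hEn hν hσt.1 hclt (hs.isSmoothSpaceTimeOn_Icc _) hfEσ hEA).1 t ⟨ht.1, htσt.le⟩
    rw [h0t] at h1
    refine h1.trans ?_
    rw [hEbd]
    gcongr
    exact hσt.2.le.trans hsStarT
  have hUs0' : HasRapidSpatialDecay (Us 0) := by rw [hUs0]; exact h0
  -- ### extension past `s⋆`: hence `s⋆ = T` and `T` is an existence time
  obtain ⟨T'', hT'', U, P, hU, hUeq, hUE⟩ :=
    ForcedContinuation.exists_extension_of_bounded_Ico hν hsStarpos hs hd hIco hUsE hUsM hUs0'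
  have hU0 : U 0 = a := by rw [hUeq 0 ⟨le_rfl, hsStarpos⟩, hUs0]
  set T₁ : ℝ := min T'' T with hT₁
  have hT₁pos : 0 < T₁ := lt_min (hsStarpos.trans hT'') hT
  have hT₁T : T₁ ≤ T := min_le_right _ _
  have hT₁mem : T₁ ∈ 𝒮 := by
    have hsub : Icc 0 T₁ ⊆ Icc 0 T'' := Icc_subset_Icc le_rfl (min_le_left _ _)
    refine ⟨hT₁pos, hT₁T, U, P, hU.mono hsub (uniqueDiffOn_Icc hT₁pos), hU0, ?_⟩
    obtain ⟨C, hC, hb⟩ := hUE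
    exact ⟨C, hC, fun t ht => hb t (hsub ht)⟩
  have hT₁le : T₁ ≤ sStar := le_csSup h𝒮bdd hT₁mem
  have hT₁eq : T₁ = T := by
    rcases le_total T'' T with h | h
    · exfalso
      have : T₁ = T'' := min_eq_left h
      linarith
    · exact min_eq_right h
  -- ### the run on `[0, T]` and its closeness to the superposition
  rw [hT₁eq] at hT₁mem
  obtain ⟨-, -, u', p', hcl', hu'0, hE'⟩ := hT₁mem
  exact ⟨u', p', hcl', hu'0, hE', fun t ht x => (bound hT le_rfl hcl' hu'0 hE' t ht x).1⟩

end Main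

end Summit.NavierStokesRegularity.FluidComputer.PalasekTowerClayBridge.SuperposedRun

end
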